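import Summits.QuantumFields.BalabanUV.Beta.FP.RelInvPeriodisedComb
import Summits.QuantumFields.BalabanUV.Beta.CombHId1Sandwich

/-!
# `BalabanUV.Beta.CombHId1Torus` — binder row D1 (OWNER an2), (J-a) dictionary, item (C2) of TID § F.10 (L2′), part THREE: **THE DOOR's GRADED `hId₁` WORD
# IS THE TORUS READING OF THE CHAIN-RULE SANDWICH** — finite block algebra on the torus box under the RULES `Ê·P = P = P·Ê`

WHY.  leaf-05 g29's `CoarseJetOrderOneGradedComb.torus_hId₁_iff_graded_comb` turns the (STEP) door's `hId₁` row at the (III′) literal into the graded word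
`−(Θᴸ·H₁·Θ) − Ŝ·Q₁₁·Θ − Θᴸ·Q₁₁ᵀ·Ŝ = c • H′₁`, `Θ (b, a) = axEc b b · P (ι b) (fμ a)`, `Θᴸ (a, b) = axEc b b · P (fμ a) (ι b)`, `Ŝ = P.submatrix fμ fμ`,
`P := perF M (GcombSh Lc j)`, `ι b = (b.1, inl b.2)`, `fμ` the coarse multiplier indices.  R-FP-57 (C2): along `h = Θ·h̄` these words ARE the chain-rule vertex
sandwich.  FILES C2a ∕ C2b put the sandwich on the torus as the PRODUCT `P · perF M (vertexOfK G Lc S^per ā) · P` read at the coarse multiplier points; this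
file is the finite algebra in between: (i) under the torus rules (leaf-05's `perF_rules_comb`: `Ê·P = P`, `P·Ê = P`, `Ê = perF M (axEc ρ Lc)` DIAGONAL with the
coarse indicator on multiplier slots — `perF_axEc`, `axEc_inr_inr`) the masks in `Θ, Θᴸ` DROP and the idle multiplier rows ∕ columns of `P` VANISH; (ii) hence
`(P·W·P).submatrix fμ fμ = Θᴸ·W_ff·Θ + Ŝ·W_mf·Θ + Θᴸ·W_fm·Ŝ + Ŝ·W_mm·Ŝ` for ANY torus matrix `W`; (iii) by bilinearity the door's word along `h = Θ·h̄` with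
`H₁, Q₁₁, Q₁₁′` the `ff ∕ mf ∕ fm` blocks of the torus tables `T_b := perF M (dper M (S b.2 b.1))` is `−Σ_ā h̄_ā • ((P·W_ā·P).submatrix fμ fμ − Ŝ·(W_ā)_mm·Ŝ)`,
`W_ā := Σ_b P (ι b) (fμ ā) • T_b` — and `W_ā = perF M (vertexOfK G Lc S^per (m ā) (ȳ ā))` when `fμ ā = (wrapPt M (Lc•ȳ ā), inr (m ā))` (C2b
`perF_vertexOfK_dper_apply` + C2a `perZ_coarse_col_eq_perF`), whose sandwich is `−perF M′ (e3OfK Lc G S^per ā)` on the coarse `ff` slots (C2b `perF_e3OfK_inl_inl`).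

CONTENT ([folklore] finite sums and the two files' letters BY NAME; no `def`, no `def … : Prop`, nothing cited, 0 sorry): §1 `sum_idx_split`, `sum_inr_eq_sum_range`;
§2 `row_idle_of_rule`, `col_idle_of_rule`, `mask_row_of_rule`, `mask_col_of_rule`; §3 **`submatrix_mul_mul_eq_blocks`**; §4 **`graded_word_eq_sum_sandwich`**;
§5 **`weightedTables_eq_perF_vertexOfK`**, **`graded_word_eq_sum_perF_e3OfK`** (GENERIC `G` with the rules as hypotheses; at the record `G := GcombSh Lc j` the rules
are leaf-05's `RelInvPeriodisedComb.perF_rules_comb` — `graded_word_eq_sum_perF_e3OfK_comb`).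

HONEST DEPENDENCY (page 1, mandatory): continuum YM on T⁴ ⇐ BetaPertH ∧ nine spine estimates (0/9 proved); BetaPertH ⇐ (D1) ∧ (D4) ∧ CAP+tail;
G-an2-4 gates asym, D1 and NE2/3/4.  HONEST FRAMING (cell contract, verbatim): «discharging `BetaPertH` makes Bałaban's UV stability UNCONDITIONAL —
a real constructive-QFT result; it is NOT the continuum limit and NOT the Clay problem.»  ABSOLUTE RULE (cell charter, verbatim): «No internally-minted
statement may enter as a cited fact. Every hypothesis is either kernel-proved in this package or a verbatim quotation of a PUBLISHED theorem with page
reference. The manuscript(s) under audit are NOT citable for their own disputed steps — they are the thing under adjudication; programme-internal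
(2001/route/tribunal) claims are never citable.»  Row D1 OWNER an2 (b2b-balaban-beta-an2) gen 42, 2026-08-22.  No existing file touched.
-/

noncomputable section

open scoped BigOperators Matrix

namespace Summit.QuantumFields.BalabanUV.Beta.CombHId1Torus

open Finset
open Literature.Probability.LatticeModels (Torus.proj)
open Literature.MathematicalPhysics.QuantumFieldTheory.Balaban1983to89
open Literature.MathematicalPhysics.QuantumFieldTheory.Balaban1983to89.Beta
open B4TorusKernel.MultiPeriod (translate translate_apply)
open B6Lemma24Torus (pbox)
open ExpKernelCalculus (MKer Decays BiLoc comp)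
open AffineAveraging (Site)
open OneStepResolventKernel (Fib)
open OneStepKernelFamily (vertexOfK)
open Summit.QuantumFields.BalabanUV.Beta.AxialDressingRooted (axEc axEc_inl_inl axEc_inr_inr)
open Summit.QuantumFields.BalabanUV.Beta.FP.KernelPeriodisationFib (Idx perF perF_apply perZ perZ_apply)
open Summit.QuantumFields.BalabanUV.Beta.FP.KernelPeriodisationFibLoc (dper dper_apply)
open Summit.QuantumFields.BalabanUV.Beta.FP.TorusGaugeCovariancePairing (wrapPt wrapPt_coe)
open Summit.QuantumFields.BalabanUV.Beta.FP.RelInvPeriodised (perF_axEc)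
open Summit.QuantumFields.BalabanUV.Beta.SpineRooted (e3OfK)

variable {d : ℕ} (M : Fin (d + 1) → ℕ) [∀ μ, NeZero (M μ)]

/-! ## §1 Splitting a torus-index sum into field and multiplier slots; the coarse multiplier slots through `fμ` -/

omit [∀ μ, NeZero (M μ)] in
/-- [folklore] `Σ_{i : Idx} F i = Σ_{(s,α)} F (s, inl α) + Σ_{(s,m)} F (s, inr m)`. -/
theorem sum_idx_split (F : Idx M (Fib d) → ℝ) :
    ∑ i : Idx M (Fib d), F i
      = ∑ b : ↥(pbox M) × Fin (d + 1), F (b.1, Sum.inl b.2) + ∑ b : ↥(pbox M) × Fin (d + 1), F (b.1, Sum.inr b.2) := by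
  rw [← (Equiv.prodSumDistrib (↥(pbox M)) (Fin (d + 1)) (Fin (d + 1))).symm.sum_comp F, Fintype.sum_sum_type]
  simp only [Equiv.prodSumDistrib_symm_apply_left, Equiv.prodSumDistrib_symm_apply_right]

omit [∀ μ, NeZero (M μ)] in
/-- [folklore] a sum over the multiplier slots of a function vanishing off the coarse ones (`range fμ`) is the sum through `fμ`. -/
theorem sum_inr_eq_sum_range {μ : Type*} [Fintype μ] [DecidableEq μ] (fμ : μ → Idx M (Fib d)) (hfμ : Function.Injective fμ)
    (hμ : ∀ a : μ, ∃ m : Fin (d + 1), (fμ a).2 = Sum.inr m) {F : Idx M (Fib d) → ℝ}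
    (hF : ∀ (s : ↥(pbox M)) (m : Fin (d + 1)), ((s, Sum.inr m) : Idx M (Fib d)) ∉ Set.range fμ → F (s, Sum.inr m) = 0) :
    ∑ b : ↥(pbox M) × Fin (d + 1), F (b.1, Sum.inr b.2) = ∑ a : μ, F (fμ a) := by
  classical
  have hιm : Function.Injective fun b : ↥(pbox M) × Fin (d + 1) => ((b.1, Sum.inr b.2) : Idx M (Fib d)) := by
    rintro ⟨s, m⟩ ⟨s', m'⟩ h
    simp only [Prod.mk.injEq, Sum.inr.injEq] at h
    exact Prod.ext h.1 h.2
  rw [← Finset.sum_image (f := F) (hιm.injOn (s := (Finset.univ : Finset (↥(pbox M) × Fin (d + 1))))),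
    ← Finset.sum_image (f := F) (hfμ.injOn (s := (Finset.univ : Finset μ)))]
  symm
  refine Finset.sum_subset ?_ ?_
  · intro i hi
    obtain ⟨a, -, rfl⟩ := Finset.mem_image.1 hi
    obtain ⟨m, hm⟩ := hμ a
    exact Finset.mem_image.2 ⟨((fμ a).1, m), Finset.mem_univ _, Prod.ext rfl hm.symm⟩
  · intro i hi hni
    obtain ⟨b, -, rfl⟩ := Finset.mem_image.1 hi
    refine hF b.1 b.2 fun ⟨a, ha⟩ => hni ?_
    exact Finset.mem_image.2 ⟨a, Finset.mem_univ _, ha⟩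

/-! ## §2 What the torus rules `Ê·P = P = P·Ê` give: idle multiplier rows ∕ columns vanish, field masks drop -/

variable {Lc : ℕ} (ρ : Fin (d + 1) → ℤ)

/-- [folklore] under `P·Ê = P`, a ROW of `P` vanishes at every idle (non-coarse) multiplier column. -/
theorem row_idle_of_rule {P : Matrix (Idx M (Fib d)) (Idx M (Fib d)) ℝ} (hPE : P * perF M (axEc ρ Lc) = P)
    (p : Idx M (Fib d)) (s : ↥(pbox M)) (m : Fin (d + 1)) (hs : Torus.proj Lc (s : Site (d + 1)) ≠ 0) :
    P p (s, Sum.inr m) = 0 := by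
  rw [← hPE, perF_axEc, Matrix.mul_diagonal, axEc_inr_inr, if_neg fun h => hs h.2.2, mul_zero]

/-- [folklore] under `Ê·P = P`, a COLUMN of `P` vanishes at every idle multiplier row. -/
theorem col_idle_of_rule {P : Matrix (Idx M (Fib d)) (Idx M (Fib d)) ℝ} (hEP : perF M (axEc ρ Lc) * P = P)
    (q : Idx M (Fib d)) (s : ↥(pbox M)) (m : Fin (d + 1)) (hs : Torus.proj Lc (s : Site (d + 1)) ≠ 0) :
    P (s, Sum.inr m) q = 0 := by
  rw [← hEP, perF_axEc, Matrix.diagonal_mul, axEc_inr_inr, if_neg fun h => hs h.2.2, zero_mul]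

/-- [folklore] under `Ê·P = P`, the field mask on a ROW index drops: `axEc s s α α · P (s, inl α) q = P (s, inl α) q`. -/
theorem mask_row_of_rule {P : Matrix (Idx M (Fib d)) (Idx M (Fib d)) ℝ} (hEP : perF M (axEc ρ Lc) * P = P)
    (b : ↥(pbox M) × Fin (d + 1)) (q : Idx M (Fib d)) :
    axEc ρ Lc (b.1 : Site (d + 1)) (b.1 : Site (d + 1)) (Sum.inl b.2) (Sum.inl b.2) * P (b.1, Sum.inl b.2) q = P (b.1, Sum.inl b.2) q := by
  conv_rhs => rw [← hEP, perF_axEc, Matrix.diagonal_mul]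

/-- [folklore] under `P·Ê = P`, the field mask on a COLUMN index drops. -/
theorem mask_col_of_rule {P : Matrix (Idx M (Fib d)) (Idx M (Fib d)) ℝ} (hPE : P * perF M (axEc ρ Lc) = P)
    (p : Idx M (Fib d)) (b : ↥(pbox M) × Fin (d + 1)) :
    axEc ρ Lc (b.1 : Site (d + 1)) (b.1 : Site (d + 1)) (Sum.inl b.2) (Sum.inl b.2) * P p (b.1, Sum.inl b.2) = P p (b.1, Sum.inl b.2) := by
  rw [mul_comm]
  conv_rhs => rw [← hPE, perF_axEc, Matrix.mul_diagonal]

/-! ## §3 The multiplier block of a triple product at the coarse slots -/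

omit [∀ μ, NeZero (M μ)] in
/-- [folklore] **`submatrix_mul_mul_eq_blocks`**: if the rows and columns of `P` at the coarse multiplier slots `fμ` vanish on the idle multiplier slots, then for
ANY `W`: `(P·W·P).submatrix fμ fμ = Pᵐᶠ·W_ff·Pᶠᵐ + Pᵐᵐ·W_mf·Pᶠᵐ + Pᵐᶠ·W_fm·Pᵐᵐ + Pᵐᵐ·W_mm·Pᵐᵐ` (`ι b = (b.1, inl b.2)`; blocks by `submatrix`). -/
theorem submatrix_mul_mul_eq_blocks {μ : Type*} [Fintype μ] [DecidableEq μ] (fμ : μ → Idx M (Fib d)) (hfμ : Function.Injective fμ)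
    (hμ : ∀ a : μ, ∃ m : Fin (d + 1), (fμ a).2 = Sum.inr m)
    (hcoarse : ∀ (s : ↥(pbox M)) (m : Fin (d + 1)), ((s, Sum.inr m) : Idx M (Fib d)) ∈ Set.range fμ ↔ Torus.proj Lc (s : Site (d + 1)) = 0)
    {P : Matrix (Idx M (Fib d)) (Idx M (Fib d)) ℝ}
    (hrow : ∀ (a : μ) (s : ↥(pbox M)) (m : Fin (d + 1)), Torus.proj Lc (s : Site (d + 1)) ≠ 0 → P (fμ a) (s, Sum.inr m) = 0)
    (hcol : ∀ (a : μ) (s : ↥(pbox M)) (m : Fin (d + 1)), Torus.proj Lc (s : Site (d + 1)) ≠ 0 → P (s, Sum.inr m) (fμ a) = 0)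
    (W : Matrix (Idx M (Fib d)) (Idx M (Fib d)) ℝ) :
    (P * W * P).submatrix fμ fμ
      = P.submatrix fμ (fun b : ↥(pbox M) × Fin (d + 1) => ((b.1, Sum.inl b.2) : Idx M (Fib d)))
          * W.submatrix (fun b : ↥(pbox M) × Fin (d + 1) => ((b.1, Sum.inl b.2) : Idx M (Fib d)))
              (fun b : ↥(pbox M) × Fin (d + 1) => ((b.1, Sum.inl b.2) : Idx M (Fib d)))
          * P.submatrix (fun b : ↥(pbox M) × Fin (d + 1) => ((b.1, Sum.inl b.2) : Idx M (Fib d))) fμ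
        + P.submatrix fμ fμ * W.submatrix fμ (fun b : ↥(pbox M) × Fin (d + 1) => ((b.1, Sum.inl b.2) : Idx M (Fib d)))
          * P.submatrix (fun b : ↥(pbox M) × Fin (d + 1) => ((b.1, Sum.inl b.2) : Idx M (Fib d))) fμ
        + P.submatrix fμ (fun b : ↥(pbox M) × Fin (d + 1) => ((b.1, Sum.inl b.2) : Idx M (Fib d)))
          * W.submatrix (fun b : ↥(pbox M) × Fin (d + 1) => ((b.1, Sum.inl b.2) : Idx M (Fib d))) fμ * P.submatrix fμ fμ
        + P.submatrix fμ fμ * W.submatrix fμ fμ * P.submatrix fμ fμ := by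
  have hidle : ∀ (s : ↥(pbox M)) (m : Fin (d + 1)), ((s, Sum.inr m) : Idx M (Fib d)) ∉ Set.range fμ → Torus.proj Lc (s : Site (d + 1)) ≠ 0 :=
    fun s m h hs => h ((hcoarse s m).2 hs)
  -- the row split `Σ_i P (fμ a) i · g i = Σ_b P (fμ a) (ι b) · g (ι b) + Σ_c P (fμ a) (fμ c) · g (fμ c)` and its column twin
  have hR : ∀ (a : μ) (g : Idx M (Fib d) → ℝ), ∑ i, P (fμ a) i * g i
      = ∑ b : ↥(pbox M) × Fin (d + 1), P (fμ a) (b.1, Sum.inl b.2) * g (b.1, Sum.inl b.2) + ∑ c : μ, P (fμ a) (fμ c) * g (fμ c) := fun a g => by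
    rw [sum_idx_split M (fun i => P (fμ a) i * g i), sum_inr_eq_sum_range M fμ hfμ hμ (F := fun i => P (fμ a) i * g i)
      fun s m h => by rw [hrow a s m (hidle s m h), zero_mul]]
  have hC : ∀ (a : μ) (g : Idx M (Fib d) → ℝ), ∑ i, g i * P i (fμ a)
      = ∑ b : ↥(pbox M) × Fin (d + 1), g (b.1, Sum.inl b.2) * P (b.1, Sum.inl b.2) (fμ a) + ∑ c : μ, g (fμ c) * P (fμ c) (fμ a) := fun a g => by
    rw [sum_idx_split M (fun i => g i * P i (fμ a)), sum_inr_eq_sum_range M fμ hfμ hμ (F := fun i => g i * P i (fμ a))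
      fun s m h => by rw [hcol a s m (hidle s m h), mul_zero]]
  ext a a'
  simp only [Matrix.add_apply, Matrix.mul_apply, Matrix.submatrix_apply]
  rw [hC a']
  simp only [hR a, add_mul, Finset.sum_add_distrib]
  abel

/-! ## §4 The door's graded word along `h = Θ·h̄` is the `h̄`-combination of sandwiches -/

omit [∀ μ, NeZero (M μ)] in
/-- [folklore] re-summation: `Σ_b (Σ_a Θ b a · h̄ a) • X b = Σ_a h̄ a • Σ_b Θ b a • X b`. -/
theorem sum_mulVec_smul {B μ V : Type*} [Fintype B] [Fintype μ] [AddCommGroup V] [Module ℝ V] (Θ : B → μ → ℝ) (hbar : μ → ℝ) (X : B → V) :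
    ∑ b, (∑ a, Θ b a * hbar a) • X b = ∑ a, hbar a • ∑ b, Θ b a • X b := by
  simp only [Finset.sum_smul, Finset.smul_sum, smul_smul, mul_comm _ (hbar _)]
  exact Finset.sum_comm

omit [∀ μ, NeZero (M μ)] in
/-- [folklore] `submatrix` is linear: `(Σ_b c b • T b).submatrix r c′ = Σ_b c b • (T b).submatrix r c′`. -/
theorem submatrix_sum_smul {B m n o p : Type*} [Fintype B] (c : B → ℝ) (T : B → Matrix m n ℝ) (r : o → m) (c' : p → n) :
    (∑ b, c b • T b).submatrix r c' = ∑ b, c b • (T b).submatrix r c' := by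
  ext i j
  simp only [Matrix.submatrix_apply, Matrix.sum_apply, Matrix.smul_apply]

omit [∀ μ, NeZero (M μ)] in
/-- [folklore] the jets along a column-combination `h b = Σ_a Θ b a · h̄ a` are the `h̄`-combinations of the blocks of `W a := Σ_b Θ b a • T b`. -/
theorem sum_smul_submatrix_of_col {I B μ o p : Type*} [Fintype B] [Fintype μ] (Θ : B → μ → ℝ) (hbar : μ → ℝ) (T : B → Matrix I I ℝ)
    (r : o → I) (c' : p → I) :
    ∑ b, (∑ a, Θ b a * hbar a) • (T b).submatrix r c' = ∑ a, hbar a • (∑ b, Θ b a • T b).submatrix r c' := by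
  rw [sum_mulVec_smul]
  refine Finset.sum_congr rfl fun a _ => ?_
  rw [submatrix_sum_smul]

/-- [folklore] **`graded_word_eq_sum_sandwich` — THE DOOR's GRADED `hId₁` WORD ALONG `h = Θ·h̄` IS THE `h̄`-COMBINATION OF TORUS SANDWICHES.**  For a torus matrix
`P` obeying the rules `Ê·P = P = P·Ê` (`Ê = perF M (axEc ρ Lc)`), coarse multiplier slots `fμ` (injective, `inr`-valued, `hcoarse`), ANY family of torus tables
`T b` (`b` a torus bond), the door's jets along `h` — `H₁ = Σ_b h b • (T b)_ff`, `Q = Σ_b h b • (T b)_{μf}`, `Q′ = Σ_b h b • (T b)_{fμ}` — and leaf-05 g29's masked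
column blocks `Θ, Θᴸ` and `Ŝ = P_{μμ}`: if `h = Θ·h̄` then
`−(Θᴸ·H₁·Θ) − Ŝ·Q·Θ − Θᴸ·Q′·Ŝ = −Σ_a h̄ a • ((P·W a·P).submatrix fμ fμ − Ŝ·(W a)_{μμ}·Ŝ)`, `W a := Σ_b P (ι b) (fμ a) • T b`. -/
theorem graded_word_eq_sum_sandwich {μ : Type*} [Fintype μ] [DecidableEq μ] (fμ : μ → Idx M (Fib d)) (hfμ : Function.Injective fμ)
    (hμ : ∀ a : μ, ∃ m : Fin (d + 1), (fμ a).2 = Sum.inr m)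
    (hcoarse : ∀ (s : ↥(pbox M)) (m : Fin (d + 1)), ((s, Sum.inr m) : Idx M (Fib d)) ∈ Set.range fμ ↔ Torus.proj Lc (s : Site (d + 1)) = 0)
    {P : Matrix (Idx M (Fib d)) (Idx M (Fib d)) ℝ} (hEP : perF M (axEc ρ Lc) * P = P) (hPE : P * perF M (axEc ρ Lc) = P)
    (T : ↥(pbox M) × Fin (d + 1) → Matrix (Idx M (Fib d)) (Idx M (Fib d)) ℝ) (hbar : μ → ℝ)
    {Θ : Matrix (↥(pbox M) × Fin (d + 1)) μ ℝ} {ΘL : Matrix μ (↥(pbox M) × Fin (d + 1)) ℝ} {Sh : Matrix μ μ ℝ} {h : ↥(pbox M) × Fin (d + 1) → ℝ}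
    (hΘ : Θ = Matrix.of fun (b : ↥(pbox M) × Fin (d + 1)) (a : μ) =>
      axEc ρ Lc (b.1 : Site (d + 1)) (b.1 : Site (d + 1)) (Sum.inl b.2) (Sum.inl b.2) * P (b.1, Sum.inl b.2) (fμ a))
    (hΘL : ΘL = Matrix.of fun (a : μ) (b : ↥(pbox M) × Fin (d + 1)) =>
      axEc ρ Lc (b.1 : Site (d + 1)) (b.1 : Site (d + 1)) (Sum.inl b.2) (Sum.inl b.2) * P (fμ a) (b.1, Sum.inl b.2))
    (hSh : Sh = P.submatrix fμ fμ) (hh : ∀ b, h b = ∑ a, Θ b a * hbar a)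
    {H₁ : Matrix (↥(pbox M) × Fin (d + 1)) (↥(pbox M) × Fin (d + 1)) ℝ} {Q : Matrix μ (↥(pbox M) × Fin (d + 1)) ℝ}
    {Q' : Matrix (↥(pbox M) × Fin (d + 1)) μ ℝ}
    (hH₁ : H₁ = ∑ b, h b • (T b).submatrix (fun b : ↥(pbox M) × Fin (d + 1) => ((b.1, Sum.inl b.2) : Idx M (Fib d)))
      (fun b : ↥(pbox M) × Fin (d + 1) => ((b.1, Sum.inl b.2) : Idx M (Fib d))))
    (hQ : Q = ∑ b, h b • (T b).submatrix fμ (fun b : ↥(pbox M) × Fin (d + 1) => ((b.1, Sum.inl b.2) : Idx M (Fib d))))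
    (hQ' : Q' = ∑ b, h b • (T b).submatrix (fun b : ↥(pbox M) × Fin (d + 1) => ((b.1, Sum.inl b.2) : Idx M (Fib d))) fμ)
    {W : μ → Matrix (Idx M (Fib d)) (Idx M (Fib d)) ℝ} (hW : W = fun a => ∑ b : ↥(pbox M) × Fin (d + 1), P (b.1, Sum.inl b.2) (fμ a) • T b) :
    -(ΘL * H₁ * Θ) - Sh * Q * Θ - ΘL * Q' * Sh
      = -∑ a, hbar a • ((P * W a * P).submatrix fμ fμ - Sh * (W a).submatrix fμ fμ * Sh) := by
  -- the masks drop under the rules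
  have hΘapp : ∀ (b : ↥(pbox M) × Fin (d + 1)) (a : μ), Θ b a = P (b.1, Sum.inl b.2) (fμ a) := fun b a => by
    rw [hΘ, Matrix.of_apply]; exact mask_row_of_rule M ρ hEP b (fμ a)
  have hΘ' : Θ = P.submatrix (fun b : ↥(pbox M) × Fin (d + 1) => ((b.1, Sum.inl b.2) : Idx M (Fib d))) fμ := by
    ext b a; rw [hΘapp, Matrix.submatrix_apply]
  have hΘL' : ΘL = P.submatrix fμ (fun b : ↥(pbox M) × Fin (d + 1) => ((b.1, Sum.inl b.2) : Idx M (Fib d))) := by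
    rw [hΘL]; ext a b; rw [Matrix.of_apply, Matrix.submatrix_apply]; exact mask_col_of_rule M ρ hPE (fμ a) b
  have hh' : ∀ b : ↥(pbox M) × Fin (d + 1), h b = ∑ a, P (b.1, Sum.inl b.2) (fμ a) * hbar a := fun b => by
    rw [hh b]; simp only [hΘapp]
  -- the jets along `h = Θ·h̄` are the `h̄`-combinations of the blocks of `W a`
  have hWff : ∑ b, h b • (T b).submatrix (fun b : ↥(pbox M) × Fin (d + 1) => ((b.1, Sum.inl b.2) : Idx M (Fib d)))
      (fun b : ↥(pbox M) × Fin (d + 1) => ((b.1, Sum.inl b.2) : Idx M (Fib d)))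
      = ∑ a, hbar a • (W a).submatrix (fun b : ↥(pbox M) × Fin (d + 1) => ((b.1, Sum.inl b.2) : Idx M (Fib d)))
          (fun b : ↥(pbox M) × Fin (d + 1) => ((b.1, Sum.inl b.2) : Idx M (Fib d))) := by
    simp only [hh']; rw [sum_smul_submatrix_of_col, hW]
  have hWmf : ∑ b, h b • (T b).submatrix fμ (fun b : ↥(pbox M) × Fin (d + 1) => ((b.1, Sum.inl b.2) : Idx M (Fib d)))
      = ∑ a, hbar a • (W a).submatrix fμ (fun b : ↥(pbox M) × Fin (d + 1) => ((b.1, Sum.inl b.2) : Idx M (Fib d))) := by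
    simp only [hh']; rw [sum_smul_submatrix_of_col, hW]
  have hWfm : ∑ b, h b • (T b).submatrix (fun b : ↥(pbox M) × Fin (d + 1) => ((b.1, Sum.inl b.2) : Idx M (Fib d))) fμ
      = ∑ a, hbar a • (W a).submatrix (fun b : ↥(pbox M) × Fin (d + 1) => ((b.1, Sum.inl b.2) : Idx M (Fib d))) fμ := by
    simp only [hh']; rw [sum_smul_submatrix_of_col, hW]
  rw [hH₁, hQ, hQ', hWff, hWmf, hWfm, hΘ', hΘL', hSh]
  -- bilinearity, then §3 term by term
  have h3 : ∀ a : μ, (P * W a * P).submatrix fμ fμ - P.submatrix fμ fμ * (W a).submatrix fμ fμ * P.submatrix fμ fμ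
      = P.submatrix fμ (fun b : ↥(pbox M) × Fin (d + 1) => ((b.1, Sum.inl b.2) : Idx M (Fib d)))
          * (W a).submatrix (fun b : ↥(pbox M) × Fin (d + 1) => ((b.1, Sum.inl b.2) : Idx M (Fib d)))
              (fun b : ↥(pbox M) × Fin (d + 1) => ((b.1, Sum.inl b.2) : Idx M (Fib d)))
          * P.submatrix (fun b : ↥(pbox M) × Fin (d + 1) => ((b.1, Sum.inl b.2) : Idx M (Fib d))) fμ
        + P.submatrix fμ fμ * (W a).submatrix fμ (fun b : ↥(pbox M) × Fin (d + 1) => ((b.1, Sum.inl b.2) : Idx M (Fib d)))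
          * P.submatrix (fun b : ↥(pbox M) × Fin (d + 1) => ((b.1, Sum.inl b.2) : Idx M (Fib d))) fμ
        + P.submatrix fμ (fun b : ↥(pbox M) × Fin (d + 1) => ((b.1, Sum.inl b.2) : Idx M (Fib d)))
          * (W a).submatrix (fun b : ↥(pbox M) × Fin (d + 1) => ((b.1, Sum.inl b.2) : Idx M (Fib d))) fμ * P.submatrix fμ fμ := fun a => by
    rw [submatrix_mul_mul_eq_blocks M fμ hfμ hμ hcoarse (fun a s m hs => row_idle_of_rule M ρ hPE (fμ a) s m hs)
      (fun a s m hs => col_idle_of_rule M ρ hEP (fμ a) s m hs) (W a)]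
    abel
  simp only [h3, Matrix.mul_sum, Matrix.sum_mul, Matrix.mul_smul, Matrix.smul_mul, smul_add, Finset.sum_add_distrib, neg_add, ← sub_eq_add_neg]


/-! ## §5 With the torus tables of a period-covariant family: the sandwiches are the periodised third jets (C2a ∕ C2b BY NAME) -/

section Record

variable {N : ℕ} {G : MKer (d + 1) (Fib d)} {S : Fin (d + 1) → Site (d + 1) → MKer (d + 1) (Fib d)}

/-- [folklore] **THE TORUS-COLUMN-WEIGHTED SUM OF THE PERIODISED TABLES IS THE TORUS MATRIX OF THE VERTEX OVER THE PERIODISED FAMILY**: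
`Σ_b P (ι b) (wrapPt M (N•ȳ), inr m) • perF M (dper M (S b.2 b.1)) = perF M (vertexOfK G N (dper M ∘ S) m ȳ)` (C2b `perF_vertexOfK_dper_apply`, C2a `perZ_coarse_col_eq_perF`). -/
theorem weightedTables_eq_perF_vertexOfK
    (hGinv : ∀ (m x z : Site (d + 1)) (a b : Fib d), G (translate M x m) (translate M z m) a b = G x z a b)
    {CG δG CS δS : ℝ} (hG : Decays G CG δG) (hδG : 0 < δG)
    (hSt : ∀ (κ : Fin (d + 1)) (u m x z : Site (d + 1)) (a b : Fib d), S κ (translate M u m) (translate M x m) (translate M z m) a b = S κ u x z a b)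
    (hS : ∀ κ u, BiLoc (S κ u) u u CS δS) (hδS : 0 < δS) (ybar : Site (d + 1)) (m : Fin (d + 1)) :
    ∑ b : ↥(pbox M) × Fin (d + 1), perF M G (b.1, Sum.inl b.2) (wrapPt M ((N : ℤ) • ybar), Sum.inr m) • perF M (dper M (S b.2 (b.1 : Site (d + 1))))
      = perF M (vertexOfK G N (fun κ u => dper M (S κ u)) m ybar) := by
  ext p q
  simp only [Matrix.sum_apply, Matrix.smul_apply, smul_eq_mul]
  rw [Fintype.sum_prod_type, CombHId1Sandwich.perF_vertexOfK_dper_apply M hGinv hG hδG hSt hS hδS m ybar p q]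
  refine Finset.sum_congr rfl fun u _ => Finset.sum_congr rfl fun κ _ => ?_
  rw [CombHId1Letters.perZ_coarse_col_eq_perF]

omit [∀ μ, NeZero (M μ)] in
/-- [folklore] tables without a multiplier–multiplier block have torus matrices without one: the `μμ` entries of any weighted sum of `perF M (dper M (S b))` vanish. -/
theorem weightedTables_inr_inr_eq_zero [∀ μ, NeZero (M μ)]
    (hSmm : ∀ (κ : Fin (d + 1)) (u x z : Site (d + 1)) (m m' : Fin (d + 1)), S κ u x z (Sum.inr m) (Sum.inr m') = 0)
    (c : ↥(pbox M) × Fin (d + 1) → ℝ) (p₁ p₂ : ↥(pbox M)) (m₁ m₂ : Fin (d + 1)) :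
    (∑ b : ↥(pbox M) × Fin (d + 1), c b • perF M (dper M (S b.2 (b.1 : Site (d + 1))))) (p₁, Sum.inr m₁) (p₂, Sum.inr m₂) = 0 := by
  simp only [Matrix.sum_apply, Matrix.smul_apply, smul_eq_mul, perF_apply, perZ_apply, dper_apply, hSmm, tsum_zero, mul_zero,
    Finset.sum_const_zero]

/-- [folklore] **`graded_word_eq_sum_perF_e3OfK` — THE DOOR's GRADED `hId₁` WORD IS THE `h̄`-COMBINATION OF THE PERIODISED THIRD JETS.**  `M = N·M′`; `G` invariant
under the fine period lattice, decaying, with the torus rules `Ê·P = P = P·Ê` for `P := perF M G`; `S` period-covariant, bond-localised, WITHOUT multiplier–multiplier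
block; coarse multiplier slots `fμ a = (wrapPt M (N•ȳ a), inr (m a))` (injective, `hcoarse`); torus tables `T b := perF M (dper M (S b.2 b.1))`; the door's jets
`H₁, Q, Q′` along `h = Θ·h̄`.  Then
`−(Θᴸ·H₁·Θ) − Ŝ·Q·Θ − Θᴸ·Q′·Ŝ = Σ_a h̄ a • of (a₁ a₂ ↦ perF M′ (e3OfK N G (dper M ∘ S) (m a) (ȳ a)) ((ȳ a₁, inl (m a₁)), (ȳ a₂, inl (m a₂))))`. -/
theorem graded_word_eq_sum_perF_e3OfK {M' : Fin (d + 1) → ℕ} [∀ μ, NeZero (M' μ)] (hM : ∀ i, M i = N * M' i)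
    (hGinv : ∀ (m x z : Site (d + 1)) (a b : Fib d), G (translate M x m) (translate M z m) a b = G x z a b)
    {CG δG CS δS : ℝ} (hG : Decays G CG δG) (hδG : 0 < δG)
    (hEP : perF M (axEc ρ Lc) * perF M G = perF M G) (hPE : perF M G * perF M (axEc ρ Lc) = perF M G)
    (hSt : ∀ (κ : Fin (d + 1)) (u m x z : Site (d + 1)) (a b : Fib d), S κ (translate M u m) (translate M x m) (translate M z m) a b = S κ u x z a b)
    (hS : ∀ κ u, BiLoc (S κ u) u u CS δS) (hδS : 0 < δS)
    (hSmm : ∀ (κ : Fin (d + 1)) (u x z : Site (d + 1)) (m m' : Fin (d + 1)), S κ u x z (Sum.inr m) (Sum.inr m') = 0)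
    {μ : Type*} [Fintype μ] [DecidableEq μ] (ybar : μ → ↥(pbox M')) (mμ : μ → Fin (d + 1))
    {fμ : μ → Idx M (Fib d)} (hf : fμ = fun a => (wrapPt M ((N : ℤ) • (ybar a : Site (d + 1))), Sum.inr (mμ a)))
    (hfμ : Function.Injective fμ)
    (hcoarse : ∀ (s : ↥(pbox M)) (m : Fin (d + 1)), ((s, Sum.inr m) : Idx M (Fib d)) ∈ Set.range fμ ↔ Torus.proj Lc (s : Site (d + 1)) = 0)
    (hbar : μ → ℝ)
    {Θ : Matrix (↥(pbox M) × Fin (d + 1)) μ ℝ} {ΘL : Matrix μ (↥(pbox M) × Fin (d + 1)) ℝ} {Sh : Matrix μ μ ℝ} {h : ↥(pbox M) × Fin (d + 1) → ℝ}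
    (hΘ : Θ = Matrix.of fun (b : ↥(pbox M) × Fin (d + 1)) (a : μ) =>
      axEc ρ Lc (b.1 : Site (d + 1)) (b.1 : Site (d + 1)) (Sum.inl b.2) (Sum.inl b.2) * perF M G (b.1, Sum.inl b.2) (fμ a))
    (hΘL : ΘL = Matrix.of fun (a : μ) (b : ↥(pbox M) × Fin (d + 1)) =>
      axEc ρ Lc (b.1 : Site (d + 1)) (b.1 : Site (d + 1)) (Sum.inl b.2) (Sum.inl b.2) * perF M G (fμ a) (b.1, Sum.inl b.2))
    (hSh : Sh = (perF M G).submatrix fμ fμ) (hh : ∀ b, h b = ∑ a, Θ b a * hbar a)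
    {H₁ : Matrix (↥(pbox M) × Fin (d + 1)) (↥(pbox M) × Fin (d + 1)) ℝ} {Q : Matrix μ (↥(pbox M) × Fin (d + 1)) ℝ}
    {Q' : Matrix (↥(pbox M) × Fin (d + 1)) μ ℝ}
    (hH₁ : H₁ = ∑ b : ↥(pbox M) × Fin (d + 1), h b • (perF M (dper M (S b.2 (b.1 : Site (d + 1))))).submatrix
      (fun b : ↥(pbox M) × Fin (d + 1) => ((b.1, Sum.inl b.2) : Idx M (Fib d))) (fun b : ↥(pbox M) × Fin (d + 1) => ((b.1, Sum.inl b.2) : Idx M (Fib d))))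
    (hQ : Q = ∑ b : ↥(pbox M) × Fin (d + 1), h b • (perF M (dper M (S b.2 (b.1 : Site (d + 1))))).submatrix fμ
      (fun b : ↥(pbox M) × Fin (d + 1) => ((b.1, Sum.inl b.2) : Idx M (Fib d))))
    (hQ' : Q' = ∑ b : ↥(pbox M) × Fin (d + 1), h b • (perF M (dper M (S b.2 (b.1 : Site (d + 1))))).submatrix
      (fun b : ↥(pbox M) × Fin (d + 1) => ((b.1, Sum.inl b.2) : Idx M (Fib d))) fμ) :
    -(ΘL * H₁ * Θ) - Sh * Q * Θ - ΘL * Q' * Sh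
      = ∑ a, hbar a • Matrix.of fun a₁ a₂ : μ =>
          perF M' (e3OfK N G (fun κ u => dper M (S κ u)) (mμ a) (ybar a : Site (d + 1))) (ybar a₁, Sum.inl (mμ a₁)) (ybar a₂, Sum.inl (mμ a₂)) := by
  have hμ : ∀ a : μ, ∃ m : Fin (d + 1), (fμ a).2 = Sum.inr m := fun a => ⟨mμ a, by rw [hf]⟩
  rw [graded_word_eq_sum_sandwich M ρ fμ hfμ hμ hcoarse hEP hPE (fun b => perF M (dper M (S b.2 (b.1 : Site (d + 1))))) hbar hΘ hΘL hSh hh hH₁ hQ hQ'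
    (W := fun a => ∑ b : ↥(pbox M) × Fin (d + 1), perF M G (b.1, Sum.inl b.2) (fμ a) • perF M (dper M (S b.2 (b.1 : Site (d + 1))))) rfl,
    ← Finset.sum_neg_distrib]
  refine Finset.sum_congr rfl fun a _ => ?_
  have hmm : (∑ b : ↥(pbox M) × Fin (d + 1), perF M G (b.1, Sum.inl b.2) (fμ a) • perF M (dper M (S b.2 (b.1 : Site (d + 1))))).submatrix fμ fμ = 0 := by
    ext a₁ a₂
    rw [Matrix.submatrix_apply, hf, Matrix.zero_apply]
    exact weightedTables_inr_inr_eq_zero M hSmm _ _ _ _ _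
  rw [hmm, Matrix.mul_zero, Matrix.zero_mul, sub_zero, ← smul_neg]
  congr 1
  ext a₁ a₂
  rw [Matrix.neg_apply, Matrix.submatrix_apply, Matrix.of_apply, hf]
  dsimp only
  rw [weightedTables_eq_perF_vertexOfK M hGinv hG hδG hSt hS hδS,
    CombHId1Sandwich.perF_e3OfK_inl_inl hM hGinv hG hδG hSt hS hδS]

end Record

/-! ## §6 At the record: `G := GcombSh Lc j` (the rules are leaf-05's `perF_rules_comb`; invariance ∕ decay are an2's `shiftK_GcombSh′` ∕ `decays_GcombSh`) -/

section Comb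

variable [NeZero Lc] {S : Fin (d + 1) → Site (d + 1) → MKer (d + 1) (Fib d)}

/-- [folklore] **`graded_word_eq_sum_perF_e3OfK_comb` — THE DOOR's GRADED `hId₁` WORD AT THE (III′) LITERAL's RESOLVENT.**  `§5` at `G := GcombSh Lc j`, `N := Lc`,
`ρ := ctr (d+1) Lc` (leaf-05 g29's literal `Θ, Θᴸ, Ŝ`), fine box `M` with `M i = Lc · M′ i`: for ANY period-covariant bond-localised table family `S` without
multiplier–multiplier block,
`−(Θᴸ·H₁·Θ) − Ŝ·Q·Θ − Θᴸ·Q′·Ŝ = Σ_a h̄ a • of (a₁ a₂ ↦ perF M′ (e3OfK Lc (GcombSh Lc j) (dper M ∘ S) (m a) (ȳ a)) ((ȳ a₁, inl (m a₁)), (ȳ a₂, inl (m a₂))))`. -/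
theorem graded_word_eq_sum_perF_e3OfK_comb {M' : Fin (d + 1) → ℕ} [∀ μ, NeZero (M' μ)] (hM : ∀ i, M i = Lc * M' i) (j : ℕ)
    {CS δS : ℝ}
    (hSt : ∀ (κ : Fin (d + 1)) (u m x z : Site (d + 1)) (a b : Fib d), S κ (translate M u m) (translate M x m) (translate M z m) a b = S κ u x z a b)
    (hS : ∀ κ u, BiLoc (S κ u) u u CS δS) (hδS : 0 < δS)
    (hSmm : ∀ (κ : Fin (d + 1)) (u x z : Site (d + 1)) (m m' : Fin (d + 1)), S κ u x z (Sum.inr m) (Sum.inr m') = 0)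
    {μ : Type*} [Fintype μ] [DecidableEq μ] (ybar : μ → ↥(pbox M')) (mμ : μ → Fin (d + 1))
    {fμ : μ → Idx M (Fib d)} (hf : fμ = fun a => (wrapPt M ((Lc : ℤ) • (ybar a : Site (d + 1))), Sum.inr (mμ a)))
    (hfμ : Function.Injective fμ)
    (hcoarse : ∀ (s : ↥(pbox M)) (m : Fin (d + 1)), ((s, Sum.inr m) : Idx M (Fib d)) ∈ Set.range fμ ↔ Torus.proj Lc (s : Site (d + 1)) = 0)
    (hbar : μ → ℝ)
    {Θ : Matrix (↥(pbox M) × Fin (d + 1)) μ ℝ} {ΘL : Matrix μ (↥(pbox M) × Fin (d + 1)) ℝ} {Sh : Matrix μ μ ℝ} {h : ↥(pbox M) × Fin (d + 1) → ℝ}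
    (hΘ : Θ = Matrix.of fun (b : ↥(pbox M) × Fin (d + 1)) (a : μ) =>
      axEc (AveragingContoursRooted.ctr (d + 1) Lc) Lc (b.1 : Site (d + 1)) (b.1 : Site (d + 1)) (Sum.inl b.2) (Sum.inl b.2)
        * perF M (CombChartStepJets.GcombSh (d := d) Lc j) (b.1, Sum.inl b.2) (fμ a))
    (hΘL : ΘL = Matrix.of fun (a : μ) (b : ↥(pbox M) × Fin (d + 1)) =>
      axEc (AveragingContoursRooted.ctr (d + 1) Lc) Lc (b.1 : Site (d + 1)) (b.1 : Site (d + 1)) (Sum.inl b.2) (Sum.inl b.2)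
        * perF M (CombChartStepJets.GcombSh (d := d) Lc j) (fμ a) (b.1, Sum.inl b.2))
    (hSh : Sh = (perF M (CombChartStepJets.GcombSh (d := d) Lc j)).submatrix fμ fμ) (hh : ∀ b, h b = ∑ a, Θ b a * hbar a)
    {H₁ : Matrix (↥(pbox M) × Fin (d + 1)) (↥(pbox M) × Fin (d + 1)) ℝ} {Q : Matrix μ (↥(pbox M) × Fin (d + 1)) ℝ}
    {Q' : Matrix (↥(pbox M) × Fin (d + 1)) μ ℝ}
    (hH₁ : H₁ = ∑ b : ↥(pbox M) × Fin (d + 1), h b • (perF M (dper M (S b.2 (b.1 : Site (d + 1))))).submatrix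
      (fun b : ↥(pbox M) × Fin (d + 1) => ((b.1, Sum.inl b.2) : Idx M (Fib d))) (fun b : ↥(pbox M) × Fin (d + 1) => ((b.1, Sum.inl b.2) : Idx M (Fib d))))
    (hQ : Q = ∑ b : ↥(pbox M) × Fin (d + 1), h b • (perF M (dper M (S b.2 (b.1 : Site (d + 1))))).submatrix fμ
      (fun b : ↥(pbox M) × Fin (d + 1) => ((b.1, Sum.inl b.2) : Idx M (Fib d))))
    (hQ' : Q' = ∑ b : ↥(pbox M) × Fin (d + 1), h b • (perF M (dper M (S b.2 (b.1 : Site (d + 1))))).submatrix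
      (fun b : ↥(pbox M) × Fin (d + 1) => ((b.1, Sum.inl b.2) : Idx M (Fib d))) fμ) :
    -(ΘL * H₁ * Θ) - Sh * Q * Θ - ΘL * Q' * Sh
      = ∑ a, hbar a • Matrix.of fun a₁ a₂ : μ =>
          perF M' (e3OfK Lc (CombChartStepJets.GcombSh (d := d) Lc j) (fun κ u => dper M (S κ u)) (mμ a) (ybar a : Site (d + 1)))
            (ybar a₁, Sum.inl (mμ a₁)) (ybar a₂, Sum.inl (mμ a₂)) := by
  have hLM : ∀ i, Lc ∣ M i := fun i => ⟨M' i, hM i⟩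
  obtain ⟨δG, CG, hδG, -, hG⟩ := CombChartStepJets.decays_GcombSh (d := d) (Lc := Lc) j
  have hGinv : ∀ (m x z : Site (d + 1)) (a b : Fib d), CombChartStepJets.GcombSh (d := d) Lc j (translate M x m) (translate M z m) a b
      = CombChartStepJets.GcombSh (d := d) Lc j x z a b :=
    FP.KernelPeriodisationFib.translate_invariant_of_shiftK M (FP.RelInvPeriodisedComb.shiftK_GcombSh' j) hLM
  obtain ⟨hEP, hPE, -, -⟩ := FP.RelInvPeriodisedComb.perF_rules_comb M hLM j
  exact graded_word_eq_sum_perF_e3OfK M (AveragingContoursRooted.ctr (d + 1) Lc) hM hGinv hG hδG hEP hPE hSt hS hδS hSmm ybar mμ hf hfμ hcoarse hbar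
    hΘ hΘL hSh hh hH₁ hQ hQ'

end Comb

end Summit.QuantumFields.BalabanUV.Beta.CombHId1Torus

end
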